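import Summits.QuantumFields.YangMills.Theorems.TunedSequenceExists.Negative.FiniteAbelianClustering
import Summits.QuantumFields.YangMills.Theorems.TunedSequenceExists.Negative.UniformClustering
import Literature.Barriers.QuantumFields.DiscreteSubgroupFreezing

/-!
# `TunedSequenceExists` — negative theorem: the window is EMPTY for finite abelian gauge groups;
# connectedness inside `IsCompactSimpleLieGroup` is load-bearing (unconditionally)

Crux `Summit.QuantumFields.YangMills.Theses.ParabolicTrajectory.TunedSequenceExists` (item
stmt-QuantumFields-10524; cdisprove gen 3). The crux quantifies over compact SIMPLE Lie groups
(`IsSimpleCompactGroup`: connected, non-abelian, …). This file proves that for every FINITE ABELIAN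
non-trivial gauge group `G` (discrete topology) and every faithful unitary lattice representation
`r`, the crux body is FALSE for every block factor `M` (`window_false_of_finite_abelian`): along any
would-be tuned witness `β_k → ∞` enters the Higgs/freezing regime `β > β_f(G, r)` of the tree's
low-temperature contour expansion (`Negative.FiniteAbelianClustering`, re-assembling
`abelianHiggs_torus_clustering` with β-uniform constants; the action gap is automatic for a
faithful unitary representation of a finite group, `actionGap_pos_of_finite`), where the curvature
correlator on the scheme's tori obeys `|⟨P ; τ_D P⟩_{β_k, 2L_k+1}| ≤ C e^{-D}` with `C` INDEPENDENT
of `β` and of the volume (`eventually_peierls_small` verifies the explicit volume condition along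
the scheme, `L_k / M^{n_k} → ∞`); hence `N_1(k) ≤ C (M^{n_k})^8 e^{-M^{n_k}} → 0`, contradicting
`N_1(k) → θ > 0`. Consequently the variant of the crux with `IsCompactSimpleLieGroup G` weakened to
"`G` non-trivial (with a faithful unitary representation)" is false
(`tunedSequenceExists_nontrivial_false`, witness `ℤ₂ ⊂ U(1)` with its defining character): beyond
non-degeneracy (`Negative.UnfaithfulFalse`; the trivial group, which is connected and fails only
the non-abelian clause) a proof of (S) must use the clauses of `IsSimpleCompactGroup` that `ℤ_n`
violates — connectedness or non-commutativity; the mechanism (freezing of a discrete gauge group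
into its Higgs phase) is the connectedness one, and the same is expected, but not proved here, for
the finite NON-abelian subgroups of `SU(2)` (which satisfy every clause of `IsSimpleCompactGroup`
except `ConnectedSpace`; the tree's contour expansion is abelian). This is the barrier
`DiscreteSubgroupFreezing` made to bite on this crux unconditionally, by the mechanism of
`Negative.UniformClustering` (there the clustering hypothesis is for all `L ≥ D`; the contour
expansion delivers it beyond an explicit threshold `L ≳ 2D`, which the scheme's tori pass).
-/

noncomputable section

namespace Summit.QuantumFields.YangMills.Theorems.TunedSequenceExists.Negative.FiniteGroupFalse

open Summit.QuantumFields.YangMills.Theorems.TunedSequenceExists.Negative.FiniteAbelianClustering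
  (abelianHiggs_torus_clustering_explicit)


section Kill

open Filter Topology MeasureTheory
open Literature.MathematicalPhysics.QuantumFieldTheory Literature.MathematicalPhysics.QuantumLattice
open Literature.Barriers.QuantumFields (wilsonEnergy actionGap actionGap_pos_of_finite rootsOfUnityCircle
  znRep continuous_znRep znRep_injective znRep_mem_unitaryGroup)
open Summit.QuantumFields.YangMills.Theorems.TunedSequenceExists.Negative.AtZeroFalse
  (tendsto_pow_of_shape eventually_sep_le_L)
open Summit.QuantumFields.YangMills.Theorems.TunedSequenceExists.Negative.UniformClustering
  (tendsto_pow_mul_const_mul_exp_neg)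

/-- `e^{1/2} < 2`. -/
theorem exp_half_lt_two : Real.exp (1 / 2) < 2 := by
  have h2 : Real.exp (1 / 2) ^ 2 < 2 ^ 2 := by
    rw [← Real.exp_nat_mul]
    have := Real.exp_one_lt_d9
    norm_num at this ⊢
    linarith
  exact lt_of_pow_lt_pow_left₀ 2 (by norm_num) h2

/-- **The Peierls smallness condition along large tori, eventually** (in the half-side `L`):
`12 · 4² · (2L+1)⁴ · 2^{-L} < e^{-D}` whenever `4D ≤ L`, for all large `L`. -/
theorem eventually_peierls_small :
    ∀ᶠ L : ℕ in atTop, ∀ D : ℕ, 4 * D ≤ L →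
      12 * ((4 : ℝ) ^ 2 * ((2 * L + 1 : ℕ) : ℝ) ^ 4 * (1 / 2 : ℝ) ^ ((2 * L + 1) / 2)) <
        Real.exp (-(D : ℝ)) := by
  set q : ℝ := Real.exp (1 / 2) / 2 with hq
  have hq0 : 0 ≤ q := by positivity
  have hq1 : q < 1 := by
    rw [hq, div_lt_one two_pos]
    exact exp_half_lt_two
  have hu : Tendsto (fun L : ℕ => (L : ℝ) ^ 4 * q ^ L) atTop (𝓝 0) :=
    tendsto_pow_const_mul_const_pow_of_lt_one 4 hq0 hq1
  have hu' : Tendsto (fun L : ℕ => (192 * 81 : ℝ) * ((L : ℝ) ^ 4 * q ^ L)) atTop (𝓝 0) := by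
    simpa using hu.const_mul (192 * 81 : ℝ)
  filter_upwards [hu'.eventually (gt_mem_nhds one_pos), eventually_ge_atTop 1] with L hL hL1 D hD
  have hdiv : (2 * L + 1) / 2 = L := by omega
  rw [hdiv]
  have hL1r : (1 : ℝ) ≤ L := by exact_mod_cast hL1
  have h3 : ((2 * L + 1 : ℕ) : ℝ) ^ 4 ≤ 81 * (L : ℝ) ^ 4 := by
    have h' : ((2 * L + 1 : ℕ) : ℝ) ≤ 3 * L := by push_cast; linarith
    calc ((2 * L + 1 : ℕ) : ℝ) ^ 4 ≤ (3 * (L : ℝ)) ^ 4 := pow_le_pow_left₀ (by positivity) h' 4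
      _ = 81 * (L : ℝ) ^ 4 := by ring
  have hhalf : (1 / 2 : ℝ) ^ L = q ^ L * Real.exp (-(L : ℝ) / 2) := by
    have h1 : q ^ L = Real.exp ((L : ℝ) / 2) / 2 ^ L := by
      rw [hq, div_pow, ← Real.exp_nat_mul]
      congr 2
      ring
    rw [h1, show -(L : ℝ) / 2 = -((L : ℝ) / 2) by ring, Real.exp_neg]
    have hE : Real.exp ((L : ℝ) / 2) ≠ 0 := (Real.exp_pos _).ne'
    field_simp
    rw [← mul_pow]; norm_num
  have hexpD : Real.exp (-(L : ℝ) / 2) ≤ Real.exp (-(D : ℝ)) := by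
    apply Real.exp_le_exp.2
    have h4 : 4 * (D : ℝ) ≤ L := by exact_mod_cast hD
    linarith
  calc 12 * ((4 : ℝ) ^ 2 * ((2 * L + 1 : ℕ) : ℝ) ^ 4 * (1 / 2 : ℝ) ^ L)
      ≤ 12 * ((4 : ℝ) ^ 2 * (81 * (L : ℝ) ^ 4) * (1 / 2 : ℝ) ^ L) := by gcongr
    _ = (192 * 81 * ((L : ℝ) ^ 4 * q ^ L)) * Real.exp (-(L : ℝ) / 2) := by rw [hhalf]; ring
    _ < 1 * Real.exp (-(L : ℝ) / 2) := mul_lt_mul_of_pos_right hL (Real.exp_pos _)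
    _ ≤ Real.exp (-(D : ℝ)) := by rw [one_mul]; exact hexpD

/-- The sup norm of the separation vector `-D e₀ ∈ ℤ⁴` is `D`. -/
theorem norm_neg_single (D : ℕ) :
    ‖(-Pi.single 0 (D : ℤ) : Literature.Probability.LatticeModels.Site 4)‖ = D := by
  have h := norm_eq_natAbs_of_max
    (-Pi.single 0 (D : ℤ) : Literature.Probability.LatticeModels.Site 4) 0 (fun j => by
      by_cases hj : j = 0
      · subst hj; exact le_rfl
      · simp [hj])
  rw [h]
  simp

variable {G : Type} [CommGroup G] [Fintype G] [TopologicalSpace G] [DiscreteTopology G]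
  [IsTopologicalGroup G] [CompactSpace G] [MeasurableSpace G] [BorelSpace G]

/-- **The window is empty for every finite abelian non-trivial gauge group** (any faithful unitary
`r`, any block factor `M`): the crux body of `TunedSequenceExists` at `(G, r, M)` is false. -/
theorem window_false_of_finite_abelian [Nontrivial G] (r : LatticeRep G) (M : ℕ) :
    ¬ (∃ θ₀ : ℝ, 0 < θ₀ ∧ ∀ θ : ℝ, 0 < θ → θ < θ₀ →
      ∃ (sch : SpeciesScheme (YMSpecies G)) (n : ℕ → ℕ),
        (∀ k, sch.a k = ((M : ℝ) ^ n k)⁻¹) ∧ Tendsto sch.β atTop atTop ∧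
        (∀ t : ℕ, 0 < t → ∃ c : ℝ, Tendsto (fun k => ((M : ℝ) ^ n k) ^ 8 *
            latticeConnectedCorr r.ρ (sch.β k) (sch.side k) r.curvature.F r.curvature.F
              (t * M ^ n k)) atTop (𝓝 c)) ∧
        Tendsto (fun k => ((M : ℝ) ^ n k) ^ 8 *
            latticeConnectedCorr r.ρ (sch.β k) (sch.side k) r.curvature.F r.curvature.F
              (M ^ n k)) atTop (𝓝 θ)) := by
  classical
  rintro ⟨θ₀, hθ₀, h⟩
  obtain ⟨sch, n, hshape, hβ, -, hlim⟩ := h (θ₀ / 2) (by positivity) (by linarith)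
  -- the degree of a faithful representation of a non-trivial group is positive
  have hN : 0 < r.N := by
    rcases Nat.eq_zero_or_pos r.N with h0 | hpos
    · exfalso
      obtain ⟨a, b, hab⟩ := exists_pair_ne G
      exact hab (r.injective (Matrix.ext fun i _ => Fin.elim0 (Fin.cast h0 i)))
    · exact hpos
  have hNr : (0 : ℝ) < r.N := by exact_mod_cast hN
  -- the action gap of the faithful unitary representation
  have hgap0 : 0 < actionGap r.ρ := actionGap_pos_of_finite r.ρ r.mem_unitary r.injective hN
  set δ : ℝ := (r.N : ℝ) * actionGap r.ρ with hδdef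
  have hδ : 0 < δ := mul_pos hNr hgap0
  have hgap : ∀ g : G, g ≠ 1 → δ ≤ (r.N : ℝ) - (r.ρ g).trace.re := fun g hg => by
    have hfin : (wilsonEnergy r.ρ '' {g : G | g ≠ 1}).Finite := (Set.toFinite _).image _
    have hle : actionGap r.ρ ≤ wilsonEnergy r.ρ g := csInf_le hfin.bddBelow ⟨g, hg, rfl⟩
    have hw : wilsonEnergy r.ρ g = 1 - ((r.N : ℝ))⁻¹ * (r.ρ g).trace.re := rfl
    have h1 : δ ≤ (r.N : ℝ) * wilsonEnergy r.ρ g := mul_le_mul_of_nonneg_left hle hNr.le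
    rw [hw, mul_sub, mul_one, ← mul_assoc, mul_inv_cancel₀ hNr.ne', one_mul] at h1
    exact h1
  -- the contour expansion, with β-uniform constants
  obtain ⟨β_f, hcl⟩ :=
    abelianHiggs_torus_clustering_explicit (d := 4) (by norm_num) r.ρ r.continuous hδ hgap
  have hloc : Literature.MathematicalPhysics.QuantumLattice.IsLocalObservable r.curvature.F :=
    ⟨r.curvature.supp, r.curvature.isCylinder⟩
  obtain ⟨C, R₀, hC⟩ := hcl r.curvature.F r.curvature.F hloc hloc r.curvature.bounded
    r.curvature.bounded r.curvature.gaugeInvariant r.curvature.gaugeInvariant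
  -- eventualities along the would-be witness
  have hD := tendsto_pow_of_shape sch hshape
  have hLk : Tendsto sch.L atTop atTop := by
    refine tendsto_atTop.2 fun b => ?_
    filter_upwards [eventually_sep_le_L sch hshape 1, tendsto_atTop.1 hD b] with k hk1 hk2
    have hb' : (b : ℝ) ≤ ((M ^ n k : ℕ) : ℝ) := by simpa [Nat.cast_pow] using hk2
    have hb : b ≤ M ^ n k := by exact_mod_cast hb'
    omega
  have hev1 : ∀ᶠ k in atTop, β_f < sch.β k := hβ.eventually_gt_atTop β_f
  have hev2 : ∀ᶠ k in atTop, 4 * M ^ n k ≤ sch.L k := eventually_sep_le_L sch hshape 4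
  have hev3 : ∀ᶠ k in atTop, ∀ D : ℕ, 4 * D ≤ sch.L k →
      12 * ((4 : ℝ) ^ 2 * ((2 * sch.L k + 1 : ℕ) : ℝ) ^ 4 * (1 / 2 : ℝ) ^ ((2 * sch.L k + 1) / 2)) <
        Real.exp (-(D : ℝ)) := hLk.eventually eventually_peierls_small
  have hev4 : ∀ᶠ k in atTop, R₀ ≤ sch.L k := tendsto_atTop.1 hLk R₀
  have hu : Tendsto (fun k => ((M : ℝ) ^ n k) ^ 8 * (C * Real.exp (-(1 * (M : ℝ) ^ n k)))) atTop
      (𝓝 0) :=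
    (tendsto_pow_mul_const_mul_exp_neg 8 one_pos C).comp hD
  have hev5 : ∀ᶠ k in atTop, ((M : ℝ) ^ n k) ^ 8 * (C * Real.exp (-(1 * (M : ℝ) ^ n k))) < θ₀ / 4 :=
    hu.eventually (gt_mem_nhds (by positivity))
  have hθ42 : θ₀ / 4 < θ₀ / 2 := by linarith
  have hev6 : ∀ᶠ k in atTop, θ₀ / 4 < ((M : ℝ) ^ n k) ^ 8 *
      latticeConnectedCorr r.ρ (sch.β k) (sch.side k) r.curvature.F r.curvature.F (M ^ n k) :=
    hlim.eventually (lt_mem_nhds hθ42)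
  obtain ⟨k, hk1, hk2, hk3, hk4, hk5, hk6⟩ :=
    (hev1.and (hev2.and (hev3.and (hev4.and (hev5.and hev6))))).exists
  -- the clustering bound at step `k`
  set D : ℕ := M ^ n k with hDdef
  set x : Literature.Probability.LatticeModels.Site 4 := -Pi.single 0 (D : ℤ) with hxdef
  have hx : ‖x‖ = D := norm_neg_single D
  have h4D : 4 * (D : ℝ) ≤ sch.L k := by exact_mod_cast hk2
  have hR₀ : (R₀ : ℝ) ≤ sch.L k := by exact_mod_cast hk4
  have hcond1 : 2 * ‖x‖ + (R₀ : ℝ) ≤ ((2 * sch.L k : ℕ) : ℝ) := by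
    rw [hx]; push_cast; linarith
  have hcond2 : 12 * ((4 : ℝ) ^ 2 * ((2 * sch.L k + 1 : ℕ) : ℝ) ^ 4 *
      (1 / 2 : ℝ) ^ ((2 * sch.L k + 1) / 2)) < Real.exp (-‖x‖) := by
    rw [hx]; exact hk3 D hk2
  have hb := hC (sch.β k) hk1 x (2 * sch.L k) hcond1 hcond2
  rw [hx] at hb
  -- translation invariance of the subtracted term
  have hshift : wilsonExpectation (L := 2 * sch.L k + 1) r.ρ (sch.β k)
      (toTorusObservable (2 * sch.L k + 1) (r.curvature.F ∘ configShift x)) =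
      wilsonExpectation (L := 2 * sch.L k + 1) r.ρ (sch.β k)
        (toTorusObservable (2 * sch.L k + 1) r.curvature.F) := by
    rw [toTorusObservable_comp_configShift]
    exact wilsonExpectation_comp_torusConfigShift (d := 4) (L := 2 * sch.L k + 1) r.ρ (sch.β k)
      (Literature.Probability.LatticeModels.Torus.proj (2 * sch.L k + 1) x)
      (toTorusObservable (2 * sch.L k + 1) r.curvature.F)
  rw [hshift] at hb
  have hb'' : |latticeConnectedCorr r.ρ (sch.β k) (2 * sch.L k + 1) r.curvature.F r.curvature.F D| ≤
      C * Real.exp (-(1 * (M : ℝ) ^ n k)) := by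
    have hcast : ((D : ℕ) : ℝ) = (M : ℝ) ^ n k := by rw [hDdef]; push_cast; rfl
    rw [← hcast]
    simpa [wilsonExpectation, toTorusObservable, latticeConnectedCorr, hxdef] using hb
  -- `sch.side k` is `2 * sch.L k + 1` by definition
  have hb' : |latticeConnectedCorr r.ρ (sch.β k) (sch.side k) r.curvature.F r.curvature.F D| ≤
      C * Real.exp (-(1 * (M : ℝ) ^ n k)) := hb''
  -- conclusion
  have hpow : (0 : ℝ) ≤ ((M : ℝ) ^ n k) ^ 8 := by positivity
  have hle := mul_le_mul_of_nonneg_left ((le_abs_self _).trans hb') hpow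
  linarith

end Kill

/-- **`TunedSequenceExists` with `IsCompactSimpleLieGroup G` weakened to "`G` non-trivial with a
faithful unitary representation" is FALSE** — witness the finite abelian gauge group `ℤ₂ ⊂ U(1)`
with its defining character (`M = 2`): non-degeneracy of `G` is not enough; the discrete theory
freezes into its Higgs phase along `β_k → ∞`. -/
theorem tunedSequenceExists_nontrivial_false :
    ¬ (∀ (G : Type) [Group G] [TopologicalSpace G] [IsTopologicalGroup G] [CompactSpace G],
        Nontrivial G → letI : MeasurableSpace G := borel G
        haveI : BorelSpace G := ⟨rfl⟩
        ∀ (r : Literature.MathematicalPhysics.QuantumFieldTheory.LatticeRep G) (M : ℕ), 2 ≤ M →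
          ∃ θ₀ : ℝ, 0 < θ₀ ∧ ∀ θ : ℝ, 0 < θ → θ < θ₀ →
          ∃ (sch : Literature.MathematicalPhysics.QuantumFieldTheory.SpeciesScheme
              (Literature.MathematicalPhysics.QuantumFieldTheory.YMSpecies G)) (n : ℕ → ℕ),
            (∀ k, sch.a k = ((M : ℝ) ^ n k)⁻¹) ∧ Filter.Tendsto sch.β Filter.atTop Filter.atTop ∧
            (∀ t : ℕ, 0 < t → ∃ c : ℝ, Filter.Tendsto (fun k => ((M : ℝ) ^ n k) ^ 8 *
                Literature.MathematicalPhysics.QuantumFieldTheory.latticeConnectedCorr r.ρ (sch.β k)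
                  (sch.side k) r.curvature.F r.curvature.F (t * M ^ n k)) Filter.atTop (nhds c)) ∧
            Filter.Tendsto (fun k => ((M : ℝ) ^ n k) ^ 8 *
                Literature.MathematicalPhysics.QuantumFieldTheory.latticeConnectedCorr r.ρ (sch.β k)
                  (sch.side k) r.curvature.F r.curvature.F (M ^ n k)) Filter.atTop (nhds θ)) := by
  intro h
  haveI : Fact (2 ≤ 2) := ⟨le_rfl⟩
  haveI : NeZero (2 : ℕ) := ⟨by norm_num⟩
  classical
  let G : Type := Literature.Barriers.QuantumFields.rootsOfUnityCircle 2
  letI : MeasurableSpace G := borel G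
  haveI : BorelSpace G := ⟨rfl⟩
  haveI : Fintype G := Fintype.ofFinite G
  let r : Literature.MathematicalPhysics.QuantumFieldTheory.LatticeRep G :=
    ⟨1, Literature.Barriers.QuantumFields.znRep 2, Literature.Barriers.QuantumFields.continuous_znRep 2,
      Literature.Barriers.QuantumFields.znRep_injective 2,
      Literature.Barriers.QuantumFields.znRep_mem_unitaryGroup 2⟩
  exact window_false_of_finite_abelian (G := G) r 2 (h G inferInstance r 2 le_rfl)

end Summit.QuantumFields.YangMills.Theorems.TunedSequenceExists.Negative.FiniteGroupFalse

end
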